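import Mathlib.Analysis.SpecialFunctions.Sqrt
import HarnessLib

/-!
# δ-capped per-interface calibration (blueprint L3 of cf-p2 R20 for RUNG B of the word-uniform
# surface ladder; crux `StackingLiminf`, stmt-Ventures-19145)

Route `StickyWulffConstant` of the venture `Summits/Ventures/Crystal3D` (cell `crystal3d-full`).
The landed `interface_calibration` (`…StackingLiminfRefinedArith.lean`, wulff-p2 g0) turns the two
interface bounds `(3/2)|p−q| ≤ β`, `(1/2)|p−q| + c√(max p q) ≤ β` and a dual triple `(θ, Ψ, Ψ₂)` into
`Ψ₂(p)/2 + Ψ₂(q)/2 + |G(p) − G(q)| ≤ β`.  The SHARP interface input `layerProfileSharp` (p464674) has a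
defect `δ = ½`: `(1/2)|p−q| + c√(max p q) − δ ≤ β` (`c = √2`).  Following cf-p2's R20 blueprint
(`BLUEPRINT-profileDual.md` §3, L3; PREREG §18) this file proves the δ-generalisation: if the weight obeys
the CAP `θ(x) ≤ 1 − δ/(c√x)` on `1 ≤ x ≤ M` and `δ(2 + c/2) ≤ c²`, the same conclusion holds for integer-like
sizes (`p, q ∈ {0} ∪ [1, M]`).  The only new lines w.r.t. the `δ = 0` lemma are the cap and the estimate
`δ(√p + √q) ≤ c²√q` in the shallow case.  Pure real arithmetic; it is the per-interface step of RUNG B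
(`c*_{√2} = ∛(531/2 + 54√6) = 7.3544`, certified by kit j262960/j262988/j263200).
WHAT THIS IS NOT: not the rung itself (the calibration `D1–D5`, the structure lemmas `L2` and the sum
estimate `L5` remain); rung F-C1 not moved.
-/

noncomputable section

namespace Summit.Ventures.Crystal3D.Theorems

/-- **δ-capped per-interface calibration** (R20 blueprint L3).  Under `(3/2)|p−q| ≤ β`,
`(1/2)|p−q| + c√(max p q) − δ ≤ β`, a weight `θ ≥ 0` with the cap `θ(x) ≤ 1 − δ/(c√x)` on `[1, M]`,
`Ψ(y) − Ψ(x) ≥ θ(x)(y − x)`, `Ψ₂(x) ≤ c θ(x) √x`, `G(x) = 3x/2 − Ψ(x) − Ψ₂(x)/2` nondecreasing on `[0, M]`,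
and `δ(2 + c/2) ≤ c²`, for sizes `p, q ∈ {0} ∪ [1, M]`:  `Ψ₂(p)/2 + Ψ₂(q)/2 + |G(p) − G(q)| ≤ β`. -/
theorem interface_calibration_cap {c δ M p q β : ℝ} {θ Ψ Ψ₂ : ℝ → ℝ}
    (hc : 0 ≤ c) (hδ : 0 ≤ δ) (hcδ : δ * (2 + c / 2) ≤ c ^ 2)
    (hp : 0 ≤ p) (hq : 0 ≤ q) (hpM : p ≤ M) (hqM : q ≤ M)
    (hp1 : p = 0 ∨ 1 ≤ p) (hq1 : q = 0 ∨ 1 ≤ q)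
    (hθ0 : ∀ x, 0 ≤ x → 0 ≤ θ x)
    (hθcap : ∀ x, 1 ≤ x → x ≤ M → θ x ≤ 1 - δ / (c * Real.sqrt x))
    (hΨ : ∀ x y, 0 ≤ x → x ≤ y → θ x * (y - x) ≤ Ψ y - Ψ x)
    (hΨ₂ : ∀ x, 0 ≤ x → Ψ₂ x ≤ c * θ x * Real.sqrt x)
    (hG : ∀ x y, 0 ≤ x → x ≤ y → y ≤ M →
      3 / 2 * x - Ψ x - Ψ₂ x / 2 ≤ 3 / 2 * y - Ψ y - Ψ₂ y / 2)
    (hβ1 : 3 / 2 * |p - q| ≤ β) (hβ2 : 1 / 2 * |p - q| + c * Real.sqrt (max p q) - δ ≤ β) :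
    Ψ₂ p / 2 + Ψ₂ q / 2 +
      |(3 / 2 * p - Ψ p - Ψ₂ p / 2) - (3 / 2 * q - Ψ q - Ψ₂ q / 2)| ≤ β := by
  -- the ordered case `q ≤ p`
  have key : ∀ p q : ℝ, 0 ≤ q → q ≤ p → p ≤ M → (q = 0 ∨ 1 ≤ q) → 3 / 2 * (p - q) ≤ β →
      1 / 2 * (p - q) + c * Real.sqrt p - δ ≤ β →
      Ψ₂ p / 2 + Ψ₂ q / 2 +
        ((3 / 2 * p - Ψ p - Ψ₂ p / 2) - (3 / 2 * q - Ψ q - Ψ₂ q / 2)) ≤ β := by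
    intro p q hq hqp hpM hq1 h1 h2
    have hθq0 := hθ0 q hq
    have hψ := hΨ q p hq hqp
    have hψ₂ := hΨ₂ q hq
    have hsq : 0 ≤ Real.sqrt q := Real.sqrt_nonneg q
    -- `LHS = 3D/2 − (Ψ p − Ψ q) + Ψ₂ q ≤ 3D/2 + θ q (c√q − D)`
    rcases le_or_gt (c * Real.sqrt q) (p - q) with hcase | hcase
    · -- steep
      have : θ q * (c * Real.sqrt q) ≤ θ q * (p - q) := mul_le_mul_of_nonneg_left hcase hθq0
      linarith [hψ, hψ₂, this, h1]
    · -- shallow: `D < c√q`, hence `q ≥ 1` and `c > 0`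
      have hq1' : 1 ≤ q := by
        rcases hq1 with h0 | h1'
        · exfalso; rw [h0, Real.sqrt_zero, mul_zero] at hcase; linarith
        · exact h1'
      have hcpos : 0 < c := by
        rcases hc.lt_or_eq with h | h
        · exact h
        · exfalso; rw [← h, zero_mul] at hcase; linarith
      set a := Real.sqrt q with ha
      set b := Real.sqrt p with hb
      have ha1 : 1 ≤ a := by rw [ha, ← Real.sqrt_one]; exact Real.sqrt_le_sqrt hq1'
      have hapos : 0 < a := by linarith
      have hab : a ≤ b := Real.sqrt_le_sqrt hqp
      have haq : a ^ 2 = q := by rw [ha, Real.sq_sqrt hq]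
      have hbp : b ^ 2 = p := by rw [hb, Real.sq_sqrt (hq.trans hqp)]
      -- `√p ≤ √q + c/2` since `p < q + c√q ≤ (√q + c/2)²`
      have hb2 : b ≤ a + c / 2 := by
        have h' : p ≤ (a + c / 2) ^ 2 := by nlinarith
        calc b = Real.sqrt p := hb
          _ ≤ Real.sqrt ((a + c / 2) ^ 2) := Real.sqrt_le_sqrt h'
          _ = a + c / 2 := Real.sqrt_sq (by linarith)
      -- the cap, multiplied out: `θ q · (c a) ≤ c a − δ`
      have hca : 0 < c * a := mul_pos hcpos hapos
      have hcap : θ q * (c * a) ≤ c * a - δ := by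
        have h := hθcap q hq1' (hqp.trans hpM)
        have : θ q * (c * a) ≤ (1 - δ / (c * a)) * (c * a) := mul_le_mul_of_nonneg_right h hca.le
        rwa [sub_mul, one_mul, div_mul_cancel₀ _ hca.ne'] at this
      -- the decisive estimate `δ D ≤ c² a (b − a)` (from `b ≤ a + c/2`, `a ≥ 1`, `δ(2 + c/2) ≤ c²`)
      have hkey : δ * (p - q) ≤ c ^ 2 * a * (b - a) := by
        have hD : p - q = (b - a) * (b + a) := by nlinarith
        rw [hD]
        have hba : 0 ≤ b - a := by linarith
        have hsum : δ * (b + a) ≤ c ^ 2 * a := by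
          have e1 : δ * b ≤ δ * (a + c / 2) := mul_le_mul_of_nonneg_left hb2 hδ
          have e2 : 0 ≤ (a - 1) * (δ * c / 2) :=
            mul_nonneg (by linarith) (by positivity)
          have e3 : a * (δ * (2 + c / 2)) ≤ a * c ^ 2 := mul_le_mul_of_nonneg_left hcδ hapos.le
          nlinarith [e1, e2, e3]
        calc δ * ((b - a) * (b + a)) = (b - a) * (δ * (b + a)) := by ring
          _ ≤ (b - a) * (c ^ 2 * a) := mul_le_mul_of_nonneg_left hsum hba
          _ = c ^ 2 * a * (b - a) := by ring
      -- `θ q (c a − D) ≤ c b − δ − D`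
      have hA : 0 < c * a - (p - q) := by linarith
      have hT : θ q * (c * a - (p - q)) * (c * a) ≤ (c * b - δ - (p - q)) * (c * a) := by
        have h3 : θ q * (c * a) * (c * a - (p - q)) ≤ (c * a - δ) * (c * a - (p - q)) :=
          mul_le_mul_of_nonneg_right hcap hA.le
        calc θ q * (c * a - (p - q)) * (c * a) = θ q * (c * a) * (c * a - (p - q)) := by ring
          _ ≤ (c * a - δ) * (c * a - (p - q)) := h3
          _ ≤ (c * b - δ - (p - q)) * (c * a) := by nlinarith [hkey]
      have hT' : θ q * (c * a - (p - q)) ≤ c * b - δ - (p - q) := le_of_mul_le_mul_right hT hca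
      linarith [hψ, hψ₂, hT', h2]
  rcases le_total q p with hqp | hpq
  · have hmax : max p q = p := max_eq_left hqp
    have habs : |p - q| = p - q := abs_of_nonneg (by linarith)
    rw [hmax] at hβ2; rw [habs] at hβ1 hβ2
    have hmono := hG q p hq hqp hpM
    rw [abs_of_nonneg (by linarith)]
    exact key p q hq hqp hpM hq1 hβ1 hβ2
  · have hmax : max p q = q := max_eq_right hpq
    have habs : |p - q| = q - p := by rw [abs_sub_comm]; exact abs_of_nonneg (by linarith)
    rw [hmax] at hβ2; rw [habs] at hβ1 hβ2
    have hmono := hG p q hp hpq hqM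
    rw [abs_of_nonpos (by linarith)]
    have := key q p hp hpq hqM hp1 hβ1 hβ2
    linarith

end Summit.Ventures.Crystal3D.Theorems
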